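import Literature.NumberTheory.EllipticCurves.BurungaleKobayashiNakamuraOta2026.RubinPadicLFunctionValuesProofs
import Summits.BirchSwinnertonDyer.BirchSwinnertonDyer.Theorems.RamifiedSevenEllipticUnitsUltrametricTransfer
import Literature.NumberTheory.EllipticCurves.Agboola2007.RestrictedSelmerDual
import HarnessLib

/-!
# Stub-ideation k = 1 (gen 7) for `stub_heegnerIndexLowerAtTwo` — crux `PrintCf2.SplitBadTwoLowerHalfOfFacts`
# (stmt-BirchSwinnertonDyer-27851), technique «weaken / strengthen»: CRITICAL-ANCHOR TRANSPORT
# (the weakest sufficient form of T1 is NO Λ-adic main conjecture at all)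

Seat `sidea-stub_heegnerIndexLowerAtTwo-1-g7` (planner, stub-ideation; scratch sketch, NOT a proposal, NOT a
skeleton; nothing is asserted about the stub, the crux or BSD — BSD is NOT proved by any of this).

THE STEP. On road α of STUB-PLAN v1.7 the LOWER child consumes the main-conjecture CONTAINMENT S3b′
«`m ≤ 2·n + e_M`» at the trivial character `T = 0` (`m/2 = ord₂ G(0)`, `G` the Katz–de Shalit branch with
`‖G(0)‖ = 2^{-m/2}` from S2′/T3; `n = ord₂ H(0)`, `H` a generator of `Ch_Λ(X)` of the LEAD's restricted dual
datum, T2⁻). Both `G ∈ 𝒪_{ℂ₂}⟦T⟧` and `H ∈ ℤ₂⟦T⟧` are 2-adically LOCALLY CONSTANT IN VALUATION near a point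
where they do not vanish (ultrametric transfer, IN TREE on both currencies: `IntSeries.norm_eq_of_lt`,
`Ultrametric.eval_valuation_eq_of_lt`). Along the LEAD's tower the in-range CRITICAL anchors
`a_N = u^{2^N} − 1` (`‖a_N‖ = 2^{-(N+2)} → 0`; characters `ε_N = ε⋆·Λ^{2^N}` of type `(2^N, 1 − 2^N)`, `v`-conductor
exponent fixed) accumulate at `T = 0`, so for ONE large `N`:  `ord₂ G(0) = ord₂ G(a_N)` and `ord₂ H(0) = ord₂ H(a_N)`,
and S3b′ at `T = 0` is IMPLIED by the same inequality AT THE ANCHOR — a rank-0, in-range, finite-level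
Tamagawa-number statement (LOWER direction) for the critical Hecke character `ε_N` of `K₀ = ℚ(√−7)` at `p = 2`,
plus in-range control (finite groups; `γ − 1` acts by `u^{2^N} − 1 ≠ 0`, B9-free) — NO one- or two-variable main
conjecture in restricted currency (T1/S3a/S3b′, R2c, Δ-sandwich all bypassed), K10-safe (only series with
NON-ZERO constant term are transported: the strict inequalities below force `G(0) ≠ 0`, `H(0) ≠ 0`).

§1 transport on both sides (PROVED, tree lemmas) · §2 a good anchor index exists (PROVED) · §3 the bookkeeping:
S3b′ and the LEAD's `lower_chain` from the anchor (PROVED, `omega`) · §4 the three research inputs as typed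
shapes (R1 = D1 interpolation at `v`-ramified anchors, de Shalit II.4.14 (36)–(37), PRINT; R2 = twisted in-range
control, Greenberg Lemma 4.2 at `T = a_N`; R3 = anchor TNC₂, LOWER direction — THE new research stub, replacing T1)
and the composition `containment_at_zero_of_anchors` (PROVED from R1–R3 + S2′-shape + T2⁻-shape).
References: de Shalit 1987 II.4.14 [deShalit1987]; Johnson-Leung–Kings 2011 Thm 5.2 [arXiv:0804.2828];
Greenberg LNM 1716 §4 [GreenbergLNM1716]; Agboola 2007 [Agboola2007]; Washington GTM 83 §7.2 [Washington1997].
-/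

set_option autoImplicit false
set_option linter.dupNamespace false

noncomputable section

namespace Summit.BirchSwinnertonDyer.BirchSwinnertonDyer.Cruxes.SplitBadTwoLowerHalfOfFacts.StubIdeasK1G7

open PowerSeries
open Literature.NumberTheory.EllipticCurves
open Summit.BirchSwinnertonDyer.BirchSwinnertonDyer.Theorems.RamifiedSevenEllipticUnits

/-! ## §1 Ultrametric transport at an anchor — both sides (helper lemmas H1a / H1b, PROVED) -/

section Transport

variable {p : ℕ} [Fact p.Prime]

/-- **H1a (analytic side).** For `G ∈ 𝒪_{ℂ_p}⟦T⟧` with value `vG` at an anchor `a` of the closed unit disc,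
`‖a‖ < ‖G(0)‖` forces `‖G(a)‖ = ‖G(0)‖`: the valuation of the branch AT THE TRIVIAL CHARACTER equals its
valuation at the anchor. (Tree: `IntSeries.norm_eq_of_lt`.) [cite: Washington1997, §7.2] -/
theorem analytic_transport (G : PowerSeries (PadicComplexInt p)) {a vG : ℂ_[p]}
    (hG : IntSeries.HasValueAt G a vG) (ha : ‖a‖ ≤ 1)
    (hlt : ‖a‖ < ‖((constantCoeff G : PadicComplexInt p) : ℂ_[p])‖) :
    ‖vG‖ = ‖((constantCoeff G : PadicComplexInt p) : ℂ_[p])‖ :=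
  IntSeries.norm_eq_of_lt hG ha hlt

/-- **H1b (algebraic side).** For `H ∈ Λ = ℤ_p⟦T⟧` and an evaluation `ev : Λ →ₐ[ℤ_p] ℤ_p` at the anchor
(`ev T = a`), `H(0) ≠ 0`, `ev T ≠ 0` and `ord_p H(0) < ord_p (ev T)` force `ev H ≠ 0` and
`ord_p H(a) = ord_p H(0)` — the shape of `RestrictedDualData.HasCharValuationAt` transported to the anchor.
(Tree: `Ultrametric.eval_valuation_eq_of_lt`.) [cite: Washington1997, §7.2] -/
theorem algebraic_transport (H : IwasawaAlgebra p) (ev : IwasawaAlgebra p →ₐ[ℤ_[p]] ℤ_[p])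
    (h0 : constantCoeff H ≠ 0) (hX : ev X ≠ 0)
    (hlt : (constantCoeff H).valuation < (ev X).valuation) :
    ev H ≠ 0 ∧ (ev H).valuation = (constantCoeff H).valuation :=
  Ultrametric.eval_valuation_eq_of_lt ev H h0 hX hlt

/-- **K10-guard (analytic).** The transport hypothesis is only satisfiable on a branch that does NOT vanish at
the trivial character: `‖a‖ < ‖G(a)‖` already forces `G(0) ≠ 0` (so the sister branch `Gp`, `Gp(0) = 0` by
Agboola's extra zero, is never transported). (Tree: `IntSeries.constantCoeff_ne_zero_of_lt`.) [cite: Agboola2007, Thm. 1] -/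
theorem constantCoeff_ne_zero_of_anchor (G : PowerSeries (PadicComplexInt p)) {a vG : ℂ_[p]}
    (hG : IntSeries.HasValueAt G a vG) (ha : ‖a‖ ≤ 1) (hlt : ‖a‖ < ‖vG‖) :
    ((constantCoeff G : PadicComplexInt p) : ℂ_[p]) ≠ 0 :=
  IntSeries.constantCoeff_ne_zero_of_lt hG ha hlt

end Transport

/-! ## §2 A good anchor index exists (helper lemma H2, PROVED) -/

/-- **H2.** The anchor norms `‖a_N‖ = 2^{-(N+2)}` eventually drop below any positive threshold (here: `‖G(0)‖`)
and the anchor valuations `ord₂ a_N = N + 2` eventually exceed any natural number (here: `ord₂ H(0)`), beyond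
any prescribed `N₀` (here: the index from which the anchor tables are constant). [cite: Washington1997, §7.2] -/
theorem exists_anchor_index (c : ℝ) (hc : 0 < c) (v N₀ : ℕ) :
    ∃ N : ℕ, N₀ ≤ N ∧ ((2 : ℝ)⁻¹) ^ (N + 2) < c ∧ v < N + 2 := by
  obtain ⟨n, hn⟩ := exists_pow_lt_of_lt_one hc (by norm_num : (2 : ℝ)⁻¹ < 1)
  refine ⟨n + v + N₀, by omega, ?_, by omega⟩
  calc ((2 : ℝ)⁻¹) ^ (n + v + N₀ + 2) ≤ ((2 : ℝ)⁻¹) ^ n :=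
        pow_le_pow_of_le_one (by norm_num) (by norm_num) (by omega)
    _ < c := hn

/-! ## §3 Bookkeeping: S3b′ and the LOWER chain from ONE anchor (helper lemma H3, PROVED) -/

/-- **H3a — S3b′ from the anchor.** Transport equalities `m = m_N` (analytic), `n = n_N` (algebraic) and the
anchor inequality (TNC₂ at `ε_N`, LOWER direction) `m_N ≤ 2·n_N + e_M` give the containment inequality at
`T = 0` in the letters of `LowerStubControl.lower_chain`. -/
theorem containment_of_anchor {m n mN nN eM : ℤ} (hG : m = mN) (hH : n = nN)
    (hTNC : mN ≤ 2 * nN + eM) : m ≤ 2 * n + eM := by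
  omega

/-- **H3b — the whole LOWER chain of road α with the anchor in place of S3b′** (letters of the T2⁻ certificate's
`lower_chain`: S2′ `m = 2A + e_A`; transport `m = m_N`, `n = n_N`; anchor TNC₂ `m_N ≤ 2 n_N + e_M`; one-sided
control `n ≤ b + c` (T2⁻, landed shape); bottom value `b ≤ B₁ + t` (V1); cokernel `c ≤ k` (V2)). -/
theorem lower_chain_of_anchor {A eA m mN n nN eM b c B₁ t k : ℤ}
    (hS2 : m = 2 * A + eA) (hG : m = mN) (hH : n = nN) (hTNC : mN ≤ 2 * nN + eM)
    (hT2 : n ≤ b + c) (hV1 : b ≤ B₁ + t) (hV2 : c ≤ k) :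
    2 * A ≤ 2 * (B₁ + t + k) + eM - eA := by
  omega

/-! ## §4 The research inputs at the anchors as typed shapes, and the composition (PROVED from the shapes)

Carriers: `G : 𝒪_{ℂ₂}⟦T⟧` (the LEAD's Katz–de Shalit branch, `IsKatzBranch …` in the S2′ frame), `H : ℤ₂⟦T⟧`
(a generator of `Ch_Λ` of the LEAD's `RestrictedDualData`, as handed over by `HasCharValuationAt`), anchors
`a N : ℂ₂` with `‖a N‖ = 2^{-(N+2)}` and evaluations `ev N : Λ →ₐ ℤ₂` at `T ↦ u^{2^N} − 1` (`ord₂ = N + 2` by the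
tree's unit-power lemma `Ultrametric.map_one_add_pow_prime_pow_sub_one` at `p = 2`, `y = u − 1 ∈ 4ℤ₂`).
Tables (ℕ-valued, indexed by `N`, per dyadic key): `s N = v₂ #𝔖_𝔮(K₀, M(ε_N))` (finite twisted restricted
Selmer group), `cM N` (twisted control correction), `cA N` (Gauss factor (37) + Euler factors + local Tamagawa /
torsion terms of the anchor TNC), `eM` the S3b′ slot. -/

/-- **R1 = D1 (PRINT, typing task; shared with k1-g6).** The branch takes, at every anchor `a_N`, the value
prescribed by de Shalit's interpolation formula II.4.14 (36)–(37) at the `v`-RAMIFIED in-range character `ε_N`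
(conductor dividing `𝔤p^∞` is allowed in print; the tree's `IsKatzBranch` currently drops `𝔭`-ramified points).
Shape only: values `vG N` at anchors of norm `2^{-(N+2)}`. [cite: deShalit1987, II.4.14 (36)–(37) (p. 71)] -/
def InterpolatesAtAnchors (G : PowerSeries (PadicComplexInt 2)) (a vG : ℕ → ℂ_[2]) : Prop :=
  ∀ N : ℕ, IntSeries.HasValueAt G (a N) (vG N) ∧ ‖a N‖ = ((2 : ℝ)⁻¹) ^ (N + 2)

/-- **R2 (twisted in-range CONTROL, Lean-M; Greenberg's Lemma 4.2 at `T = a_N` instead of `T = 0`).** At the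
anchor the specialisation `X/(T − a_N)X` is controlled by the FINITE twisted restricted Selmer group over `K₀`:
`ord₂ H(a_N) = s_N + cM_N` whenever `H(a_N) ≠ 0`, with `cM_N` an explicit local table (no `H¹(Γ, ·)` of a
divisible module with trivial action: `γ` acts on the twist by `u^{2^N} ≠ 1`, B9-free).
[cite: GreenbergLNM1716, §4 Lemma 4.2] [cite: Agboola2007, §3 Prop. 3.2, §5] -/
def TwistedControlAtAnchors (H : IwasawaAlgebra 2) (ev : ℕ → (IwasawaAlgebra 2 →ₐ[ℤ_[2]] ℤ_[2]))
    (s cM : ℕ → ℕ) : Prop :=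
  ∀ N : ℕ, (ev N) X ≠ 0 ∧ ((ev N) X).valuation = N + 2 ∧
    ((ev N) H ≠ 0 → ((ev N) H).valuation = s N + cM N)

/-- **R3 (THE research stub replacing T1: anchor TNC₂, LOWER direction, eventually in `N`).** For `N ≥ N₀` the
critical value at the anchor is AT MOST as 2-divisible as the twisted Selmer group and the local terms allow:
`2·ord₂ vG_N ≤ 2(s_N + cA_N) + e_M`, i.e. `‖vG_N‖ ≥ 2^{-(2(s_N + cA_N) + e_M)/2}` — the non-Euler-system half of the
Tamagawa number conjecture for the rank-0 in-range Hecke character `ε_N` of `ℚ(√−7)` at `p = 2` (provenance: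
Johnson-Leung–Kings' two-variable `Λ`-main conjecture, an EQUALITY for all `p`, descended at an in-range point).
[cite: JohnsonLeungKings2011, Thm. 5.2 (arXiv:0804.2828 p. 14)] [cite: deShalit1987, II.4.14] -/
def AnchorTNCLower (vG : ℕ → ℂ_[2]) (s cA : ℕ → ℕ) (eM : ℤ) (N₀ : ℕ) : Prop :=
  ∀ N : ℕ, N₀ ≤ N →
    (2 : ℝ) ^ (-(((2 * ((s N : ℤ) + (cA N : ℤ)) + eM : ℤ) : ℝ)) / 2) ≤ ‖vG N‖

/-- **COMPOSITION (PROVED): S3b′ at the trivial character from the anchors, with NO main conjecture at `T = 0`.**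
From R1–R3, the S2′-shape `‖G(0)‖ = 2^{-m/2}` and the T2⁻-shape `H(0) ≠ 0 ∧ ord₂ H(0) = n` (both in tree as
shapes: `IsKatzBranch`/S2′, `RestrictedDualData.HasCharValuationAt`): there is an anchor `N ≥ N₀` with
`m ≤ 2n + (e_M + 2(cA_N − cM_N))` — S3b′'s inequality with the slot `e_M′ = e_M + 2(cA_N − cM_N)`, which R4
(eventual constancy of the tables, bookkeeping) turns into a number per dyadic key (B8). -/
theorem containment_at_zero_of_anchors
    (G : PowerSeries (PadicComplexInt 2)) (H : IwasawaAlgebra 2)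
    (a vG : ℕ → ℂ_[2]) (ev : ℕ → (IwasawaAlgebra 2 →ₐ[ℤ_[2]] ℤ_[2]))
    (s cA cM : ℕ → ℕ) (eM : ℤ) (N₀ : ℕ) {m : ℤ} {n : ℕ}
    (hR1 : InterpolatesAtAnchors G a vG) (hR2 : TwistedControlAtAnchors H ev s cM)
    (hR3 : AnchorTNCLower vG s cA eM N₀)
    (hS2 : ‖((constantCoeff G : PadicComplexInt 2) : ℂ_[2])‖ = (2 : ℝ) ^ (-(m : ℝ) / 2))
    (hT2 : constantCoeff H ≠ 0 ∧ (constantCoeff H).valuation = n) :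
    ∃ N : ℕ, N₀ ≤ N ∧ (n : ℤ) = s N + cM N ∧
      m ≤ 2 * (n : ℤ) + (eM + 2 * ((cA N : ℤ) - (cM N : ℤ))) := by
  -- a good anchor: below `‖G(0)‖` in norm, above `ord₂ H(0)` in valuation, beyond `N₀`
  have hc : 0 < ‖((constantCoeff G : PadicComplexInt 2) : ℂ_[2])‖ := by
    rw [hS2]; exact Real.rpow_pos_of_pos (by norm_num) _
  obtain ⟨N, hN0, h1, h2⟩ := exists_anchor_index _ hc n N₀
  -- analytic transport at `N`
  have ha1 : ‖a N‖ ≤ 1 := by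
    rw [(hR1 N).2]; exact pow_le_one₀ (by norm_num) (by norm_num)
  have hlt : ‖a N‖ < ‖((constantCoeff G : PadicComplexInt 2) : ℂ_[2])‖ := by
    rw [(hR1 N).2]; exact h1
  have hvG : ‖vG N‖ = ‖((constantCoeff G : PadicComplexInt 2) : ℂ_[2])‖ :=
    analytic_transport G (hR1 N).1 ha1 hlt
  -- the anchor inequality read at `T = 0`
  have hR3' : (2 : ℝ) ^ (-(((2 * ((s N : ℤ) + (cA N : ℤ)) + eM : ℤ) : ℝ)) / 2) ≤
      (2 : ℝ) ^ (-(m : ℝ) / 2) := by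
    rw [← hS2, ← hvG]; exact hR3 N hN0
  have h4 : (m : ℝ) ≤ (((2 * ((s N : ℤ) + (cA N : ℤ)) + eM : ℤ) : ℝ)) := by
    have := (Real.rpow_le_rpow_left_iff (show (1 : ℝ) < 2 by norm_num)).1 hR3'
    linarith
  have h4' : m ≤ 2 * ((s N : ℤ) + (cA N : ℤ)) + eM := by exact_mod_cast h4
  -- algebraic transport at `N`
  obtain ⟨hX, hXv, hctrl⟩ := hR2 N
  have hlt' : (constantCoeff H).valuation < ((ev N) X).valuation := by
    rw [hT2.2, hXv]; exact h2
  obtain ⟨hevH, hval⟩ := algebraic_transport H (ev N) hT2.1 hX hlt'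
  have h5 : n = s N + cM N := by
    have h := hctrl hevH
    rw [hval, hT2.2] at h
    exact h
  have h5' : (n : ℤ) = s N + cM N := by exact_mod_cast h5
  exact ⟨N, hN0, h5', by omega⟩

end Summit.BirchSwinnertonDyer.BirchSwinnertonDyer.Cruxes.SplitBadTwoLowerHalfOfFacts.StubIdeasK1G7

end
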